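import Mathlib.Algebra.Polynomial.HasseDeriv
import Mathlib.Algebra.Polynomial.Taylor
import Mathlib.RingTheory.Localization.AtPrime.Basic
import Mathlib.RingTheory.Ideal.Maps
import Mathlib.RingTheory.Polynomial.Basic
import Mathlib.RingTheory.Ideal.Quotient.Operations
import Mathlib.Algebra.Ring.GeomSum
import Mathlib.Tactic.LinearCombination
import Mathlib.Algebra.Polynomial.Div
import Mathlib.Algebra.Polynomial.FieldDivision
import Mathlib.RingTheory.PrincipalIdealDomain
import Mathlib.FieldTheory.Minpoly.Field
import Mathlib.FieldTheory.KummerPolynomial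
import Mathlib.Algebra.Squarefree.Basic
import Mathlib.RingTheory.Adjoin.Polynomial.Basic
import Mathlib.RingTheory.Localization.FractionRing
import HarnessLib

/-!
# Cossart–Piltant 2019, the local theorem: first bricks of the printed proof (§2, p. 9 of arXiv v1)

Topic: `Literature/AlgebraicGeometry/Resolution` (proofs only: no new notions, no named facts).
Helper theorems towards `CossartPiltant2019Local_holds` (`ArithmeticalThreefoldsLocal.lean`,
journal Thm. 1.5 = arXiv v1 Thm. 1.4), mirroring the opening of Ch. 2 "Adapted structure and
primary invariants" of the paper (arXiv v1 p. 9), where for a regular local ring `S`, a monic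
("unitary") `h = X^m + f_{1,X} X^{m-1} + ⋯ + f_{m,X} ∈ S[X]` and the hypersurface
`𝒳 = Spec S[X]/(h)`, the **multiplicity** of a point `y ∈ 𝒳` is

> "`m(y) = ord_{m_{S[X]_y}} h`", `Sing 𝒳 = {y : m(y) ≥ 2}`,
> "`Sing_m 𝒳 := {y ∈ Spec S[X] : ord_{m_{S[X]_y}} h = m} ⊆ Sing 𝒳`",

the order function of a local ring `(A, 𝔪)` being `ord_𝔪 f := sup {n ∈ ℕ : f ∈ 𝔪ⁿ}` (ibid.).
Orders are phrased by membership in powers, as in `OrderGenerization.lean` /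
`OrderGenericAlongPrime.lean`: "`ord_y h ≥ n`" is `h/1 ∈ (𝔓 S[X]_𝔓)ⁿ`, equivalently
`s h ∈ 𝔓ⁿ` for some `s ∉ 𝔓` (`𝔓` the prime of `y`).

## Content (namespace `Literature.AlgebraicGeometry.Resolution`)

* `Polynomial.hasseDeriv_mem_pow` — PROVED: Hasse derivatives lower the `I`-adic order by at
  most their order, `f ∈ Iⁿ ⇒ D⁽ᵏ⁾ f ∈ Iⁿ⁻ᵏ`, for every ideal `I ⊆ R[X]` (Leibniz rule
  `hasseDeriv_mul`).
* `Polynomial.pow_mul_hasseDeriv_mem_pow` — PROVED: the symbolic form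
  `s g ∈ Iⁿ ⇒ s^{k+1} D⁽ᵏ⁾ g ∈ Iⁿ⁻ᵏ` (strong induction on `k`).
* `Polynomial.Monic.not_mul_mem_pow_of_natDegree_lt`,
  `Polynomial.Monic.le_natDegree_of_algebraMap_mem_maximalIdeal_pow` — PROVED: **`m(y) ≤ m`**:
  for `h` monic of degree `m` and any prime `𝔓` of `R[X]`, `h/1 ∉ (𝔓 R[X]_𝔓)^{m+1}`, i.e. every
  point of `Spec R[X]` has `ord_y h ≤ deg h` (the top stratum is `Sing_m 𝒳`; in the paper
  this is the remark that `P = (0,…,0,1) ∈ (1/m) NP(h; u; X)`, p. 9);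
  `IsLocalization.AtPrime.algebraMap_mem_maximalIdeal_pow_iff` is the dictionary
  `h/1 ∈ (𝔓 A_𝔓)ⁿ ⟺ ∃ s ∉ 𝔓, s h ∈ 𝔓ⁿ` (no domain hypothesis).
* `Polynomial.mem_sup_span_X_pow_iff`, `Polynomial.mem_sup_span_X_sub_C_pow_iff`,
  `Polynomial.mem_sup_span_X_sub_C_pow_natDegree_iff` — PROVED: **the order at a rational
  point is read off the expansion (2.3)** (v1 p. 9: `X' := X - φ`,
  `h = X'^m + f_{1,X'} X'^{m-1} + ⋯ + f_{m,X'}`, so `f_{i,X'} = coeff_{m-i} (taylor φ h)`): for any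
  ideal `𝔞 ⊆ R` and `a ∈ R`, `g ∈ (𝔞 R[X] + (X - a))ⁿ ⟺ coeff_b (g(X + a)) ∈ 𝔞ⁿ⁻ᵇ ∀ b`; in
  particular `h ∈ (𝔞, X - a)^{deg h} ⟺ f_{i,X-a} ∈ 𝔞ⁱ` for `1 ≤ i ≤ deg h` — with `𝔞 = m_S`
  this is "`m(x) = m`" at the closed point `x = (m_S, X - a)` (powers of the maximal ideal
  `(m_S, X - a)` being primary, `ord_x` is computed in `S[X]`).

* `Ideal.IsMaximal.mem_pow_of_mul_mem_pow`, `Ideal.IsMaximal.algebraMap_mem_maximalIdeal_pow_iff`,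
  `Polynomial.sup_span_X_sub_C_eq_ker`, `Polynomial.isMaximal_sup_span_X_sub_C`,
  `Polynomial.algebraMap_mem_maximalIdeal_pow_iff_coeff_taylor`,
  `Polynomial.algebraMap_mem_maximalIdeal_pow_natDegree_iff` — PROVED: `𝔑 = (𝔞, X - a)` is a
  closed point for `𝔞` maximal (kernel of `g ↦ g(a) mod 𝔞`), powers of a maximal ideal are
  primary, hence **`ord_x` in the local ring `R[X]_𝔑` (the paper's `ord_{m_{S[X]_x}}`, so
  `m(x)` at `h`) is read off the expansion (2.3)**: `g/1 ∈ (𝔑 R[X]_𝔑)ⁿ ⟺ coeff_b g(X + a) ∈ 𝔞ⁿ⁻ᵇ`,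
  and `m(x) = m ⟺ f_{i,X-a} ∈ 𝔞ⁱ` (`1 ≤ i ≤ m`).
* `Polynomial.exists_eq_X_sub_C_pow_of_mul_mem_pow`,
  `Polynomial.Monic.exists_eq_sup_span_X_sub_C_of_mul_mem_pow` — PROVED: the step "`x ∈ Sing_m 𝒳`
  implies `h̄(Z) = (Z - λ)^m` for some `λ ∈ S/m_S`" of the proof of Prop. 2.3 (v1 pp. 11–12): a
  point of `Spec R[X]` over the maximal ideal `𝔞` at which the monic `h` of degree `m ≥ 1` has
  order `≥ m` is the rational closed point `(𝔞, X - a)` for some `a ∈ R`, and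
  `h ≡ (X - a)^m mod 𝔞 R[X]`; and then (`Polynomial.eq_sup_span_X_sub_C_of_map_eq_X_sub_C_pow`)
  the fibre of `Spec R[X]/(h)` over `𝔞` is that single point (the elementary half of
  Prop. 2.3 (i), v1 p. 11).
* `Polynomial.exists_prime_pow_dvd_map_of_mul_mem_pow`, `Polynomial.mem_of_mul_mem_sq_of_squarefree_map`,
  `Polynomial.exists_map_eq_X_sub_C_pow_of_purelyInseparable` — PROVED: `ord_𝔑 h ≥ n ⇒ πⁿ ∣ h̄`
  for the prime factor `π` of `h̄ = h mod 𝔞` cut out by `𝔑`; a squarefree ("reduced") `h̄` has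
  no singular point over `𝔞`; and **case (c) of (G)** (v1 §2.3: `char S = p`,
  `f_{1,X} = ⋯ = f_{p-1,X} = 0`, so `h̄ = X^p - c̄`): a singular point over `m_S` forces
  `h̄ = (X - λ)^p`, `λ ∈ S/m_S` — the claims "`η⁻¹(s) = {x}`, `k(x) = k(s)`" of **Prop. 2.10**
  (v1 p. 15) for `x ∈ Sing 𝒳` over `s = m_S` in that case (Kummer: `X^p - c̄` is a `p`-th power
  or irreducible).
* `Polynomial.Monic.aeval_eq_zero_iff_dvd_of_irreducible_map`,
  `Polynomial.Monic.ker_aeval_eq_span_of_irreducible_map`,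
  `Polynomial.Monic.nonempty_quotient_span_algEquiv_adjoin` — PROVED: the hypersurface of the
  Lean statement `CossartPiltant2019Local` (`S[x] = Algebra.adjoin S {x} ⊆ L`, `x` a root of the
  monic `h`, `h` irreducible over `K = Frac S`) IS the paper's `𝒳 = Spec S[X]/(h)` (v1 p. 9,
  (2.2)): `ker (S[X] → L, X ↦ x) = (h)` and `S[X]/(h) ≃ₐ[S] S[x]`.

Deliberately NOT here: the characteristic polyhedron `Δ_S(h; u; X)` and the invariants of
§§2.1–2.7 (`δ`, `d_j`, `ε`, `ω`, `κ`), which need definitions; Prop. 2.3 itself (it is about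
minimal polyhedra).

## Sources

* V. Cossart, O. Piltant, *Resolution of singularities of arithmetical threefolds*, J. Algebra
  529 (2019) 268–535 = arXiv:1412.0868, Ch. 2 (arXiv v1 p. 9: order function, `m(y)`, `Sing 𝒳`,
  `Sing_m 𝒳`, expansion (2.3); pp. 11–12: Prop. 2.3 and its proof; p. 15: §2.3, assumption (G),
  cases (a)–(c), Prop. 2.10 and its proof). [CossartPiltant2019]
-/

noncomputable section

open Polynomial Finset IsLocalRing

namespace Literature.AlgebraicGeometry.Resolution

universe u

variable {R : Type u} [CommRing R]

/-! ## Hasse derivatives and orders along an ideal of `R[X]` -/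

/-- **Hasse derivatives lower the order along any ideal by at most their order**: if `f ∈ Iⁿ`
for an ideal `I ⊆ R[X]` then `D⁽ᵏ⁾ f ∈ Iⁿ⁻ᵏ` (truncated subtraction). By induction on `n` with
the Leibniz rule `D⁽ᵏ⁾(ab) = Σ_{i+j=k} D⁽ⁱ⁾a · D⁽ʲ⁾b`. [folklore] -/
theorem Polynomial.hasseDeriv_mem_pow {I : Ideal R[X]} {n : ℕ} {f : R[X]} (hf : f ∈ I ^ n)
    (k : ℕ) : hasseDeriv k f ∈ I ^ (n - k) := by
  induction n generalizing k f with
  | zero => simp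
  | succ n ih =>
    rw [pow_succ] at hf
    refine Submodule.mul_induction_on hf (fun a ha b hb => ?_) (fun x y hx hy => ?_)
    · rw [hasseDeriv_mul]
      refine Submodule.sum_mem _ fun ij hij => ?_
      rw [mem_antidiagonal] at hij
      rcases Nat.eq_zero_or_pos ij.2 with h2 | h2
      · -- the term `D⁽ᵏ⁾ a · b ∈ Iⁿ⁻ᵏ · I`
        have hk : ij.1 = k := by omega
        rw [h2, hasseDeriv_zero', hk]
        have hmem : hasseDeriv k a * b ∈ I ^ (n - k + 1) := by
          rw [pow_succ]
          exact Ideal.mul_mem_mul (ih ha k) hb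
        exact Ideal.pow_le_pow_right (by omega) hmem
      · -- the terms `D⁽ⁱ⁾ a · D⁽ʲ⁾ b` with `j ≥ 1`, `i ≤ k - 1`
        have hmem : hasseDeriv ij.1 a * hasseDeriv ij.2 b ∈ I ^ (n - ij.1) :=
          Ideal.mul_mem_right _ _ (ih ha ij.1)
        exact Ideal.pow_le_pow_right (by omega) hmem
    · rw [map_add]
      exact Ideal.add_mem _ hx hy

/-- **Symbolic form**: if `s g ∈ Iⁿ` then `s^{k+1} D⁽ᵏ⁾ g ∈ Iⁿ⁻ᵏ`. (From
`D⁽ᵏ⁾(s g) = s D⁽ᵏ⁾ g + Σ_{i ≥ 1} D⁽ⁱ⁾ s · D⁽ᵏ⁻ⁱ⁾ g` and strong induction on `k`.) With `s ∉ 𝔓`,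
`I = 𝔓` prime, this says that Hasse derivatives lower the order `ord_{𝔓 R[X]_𝔓}` by at most
their order. [folklore] -/
theorem Polynomial.pow_mul_hasseDeriv_mem_pow {I : Ideal R[X]} {n : ℕ} {s g : R[X]}
    (h : s * g ∈ I ^ n) (k : ℕ) : s ^ (k + 1) * hasseDeriv k g ∈ I ^ (n - k) := by
  induction k using Nat.strong_induction_on with
  | _ k ih =>
    have hD : hasseDeriv k (s * g) ∈ I ^ (n - k) := Polynomial.hasseDeriv_mem_pow h k
    have hsplit : hasseDeriv k (s * g) =
        (∑ i ∈ range k, hasseDeriv (i + 1) s * hasseDeriv (k - (i + 1)) g) +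
          s * hasseDeriv k g := by
      rw [hasseDeriv_mul, Nat.sum_antidiagonal_eq_sum_range_succ
        (fun i j => hasseDeriv i s * hasseDeriv j g) k, Finset.sum_range_succ']
      simp
    have key : s * hasseDeriv k g = hasseDeriv k (s * g) -
        ∑ i ∈ range k, hasseDeriv (i + 1) s * hasseDeriv (k - (i + 1)) g := by
      rw [hsplit]; ring
    have : s ^ (k + 1) * hasseDeriv k g = s ^ k * (s * hasseDeriv k g) := by ring
    rw [this, key, mul_sub, Finset.mul_sum]
    refine Ideal.sub_mem _ (Ideal.mul_mem_left _ _ hD) (Submodule.sum_mem _ fun i hi => ?_)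
    rw [Finset.mem_range] at hi
    have hj : k - (i + 1) < k := by omega
    have hrec := ih (k - (i + 1)) hj
    have hpow : s ^ k = s ^ i * s ^ (k - (i + 1) + 1) := by
      rw [← pow_add]; congr 1; omega
    have : s ^ k * (hasseDeriv (i + 1) s * hasseDeriv (k - (i + 1)) g) =
        (s ^ i * hasseDeriv (i + 1) s) * (s ^ (k - (i + 1) + 1) * hasseDeriv (k - (i + 1)) g) := by
      rw [hpow]; ring
    rw [this]
    exact Ideal.mul_mem_left _ _ (Ideal.pow_le_pow_right (by omega) hrec)

/-! ## `m(y) ≤ deg h` for monic `h` (Cossart–Piltant 2019, Ch. 2, v1 p. 9) -/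

/-- **The order of a monic polynomial along a prime is at most its degree**, symbolic-power form:
if `h ∈ R[X]` is monic, `𝔓 ⊆ R[X]` is prime, `s ∉ 𝔓` and `n > deg h`, then `s h ∉ 𝔓ⁿ`. Indeed
`D⁽ᵐ⁾ h = 1` for `m = deg h`, so `s^{m+1} = s^{m+1} D⁽ᵐ⁾ h ∈ 𝔓ⁿ⁻ᵐ ⊆ 𝔓`. This is "`m(y) ≤ m`" for
every point `y` of `𝒳 = Spec S[X]/(h)` in the notation of Cossart–Piltant
(`m(y) = ord_{m_{S[X]_y}} h`). [cite: CossartPiltant2019, Ch. 2 (arXiv v1 p. 9)] -/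
theorem Polynomial.Monic.not_mul_mem_pow_of_natDegree_lt {P : Ideal R[X]} [P.IsPrime] {h : R[X]}
    (hh : h.Monic) {s : R[X]} (hs : s ∉ P) {n : ℕ} (hn : h.natDegree < n) : s * h ∉ P ^ n := by
  intro hmem
  have key := Polynomial.pow_mul_hasseDeriv_mem_pow hmem h.natDegree
  rw [hasseDeriv_natDegree_eq_C, hh.leadingCoeff, C_1, mul_one] at key
  have hle : P ^ (n - h.natDegree) ≤ P := Ideal.pow_le_self (by omega)
  exact hs (‹P.IsPrime›.mem_of_pow_mem _ (hle key))

/-- In a localization `S` of `A` at a prime `Q`: `x/1 ∈ (Q S)ⁿ` iff `s x ∈ Qⁿ` for some `s ∉ Q`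
(no domain hypothesis). [folklore] -/
theorem IsLocalization.AtPrime.algebraMap_mem_maximalIdeal_pow_iff {A : Type*} [CommRing A]
    (Q : Ideal A) [Q.IsPrime] (S : Type*) [CommRing S] [Algebra A S] [IsLocalization.AtPrime S Q]
    [IsLocalRing S] {n : ℕ} {x : A} :
    algebraMap A S x ∈ maximalIdeal S ^ n ↔ ∃ s ∉ Q, s * x ∈ Q ^ n := by
  rw [← IsLocalization.AtPrime.map_eq_maximalIdeal Q S, ← Ideal.map_pow]
  constructor
  · intro hx
    rw [IsLocalization.mem_map_algebraMap_iff Q.primeCompl S] at hx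
    obtain ⟨⟨⟨i, hi⟩, ⟨s, hs⟩⟩, h⟩ := hx
    have h' : algebraMap A S (s * x) = algebraMap A S i := by
      rw [map_mul, mul_comm]; exact h
    obtain ⟨⟨c, hc⟩, hcx⟩ := (IsLocalization.eq_iff_exists Q.primeCompl S).mp h'
    refine ⟨c * s, fun hmem => ?_, ?_⟩
    · rcases ‹Q.IsPrime›.mem_or_mem hmem with h1 | h1
      · exact hc h1
      · exact hs h1
    · rw [mul_assoc, hcx]
      exact Ideal.mul_mem_left _ _ hi
  · rintro ⟨s, hs, hsx⟩
    have hu : IsUnit (algebraMap A S s) := IsLocalization.map_units S (⟨s, hs⟩ : Q.primeCompl)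
    rw [← Ideal.unit_mul_mem_iff_mem _ hu, ← map_mul]
    exact Ideal.mem_map_of_mem _ hsx

/-- **`m(y) ≤ deg h`**, local-ring form (Cossart–Piltant 2019, Ch. 2, v1 p. 9:
`m(y) = ord_{m_{S[X]_y}} h` for the monic `h` of (2.2)): if `h` is monic and
`h/1 ∈ (𝔓 R[X]_𝔓)ⁿ` for a prime `𝔓` of `R[X]`, then `n ≤ deg h`. In particular the multiplicity
of every point of the hypersurface `Spec S[X]/(h)` is at most `m = deg h`, and `Sing_m` is the
top stratum. [cite: CossartPiltant2019, Ch. 2 (arXiv v1 p. 9)] -/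
theorem Polynomial.Monic.le_natDegree_of_algebraMap_mem_maximalIdeal_pow {P : Ideal R[X]}
    [P.IsPrime] {h : R[X]} (hh : h.Monic) (S : Type*) [CommRing S] [Algebra R[X] S]
    [IsLocalization.AtPrime S P] [IsLocalRing S] {n : ℕ}
    (hn : algebraMap R[X] S h ∈ maximalIdeal S ^ n) : n ≤ h.natDegree := by
  by_contra hlt
  obtain ⟨s, hs, hsx⟩ :=
    (IsLocalization.AtPrime.algebraMap_mem_maximalIdeal_pow_iff P S).mp hn
  exact Polynomial.Monic.not_mul_mem_pow_of_natDegree_lt hh hs (not_le.mp hlt) hsx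

/-! ## The order at a rational point: `ord_{(𝔞, X - a)}` is read off the Taylor coefficients

Cossart–Piltant expand `h` in `X' := X - φ` (v1 p. 9, (2.3)): `h = X'^m + f_{1,X'} X'^{m-1} + ⋯ +
f_{m,X'}`, i.e. `f_{i,X'}` is the coefficient of `X'^{m-i}` in `taylor φ h = h(X + φ)`. At the
closed point `x = (m_S, X - a)` of `Spec S[X]` the order of any `g` is read off these
coefficients: `g ∈ (m_S, X - a)ⁿ ⟺ coeff_b (taylor a g) ∈ m_S^{n-b}` for all `b`. We prove this
for an arbitrary ideal `𝔞` of an arbitrary commutative ring `R` in place of `m_S`. -/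

/-- An element of `𝔞 R[X] + (X)` has constant coefficient in `𝔞`. [folklore] -/
theorem Polynomial.coeff_zero_mem_of_mem_sup_span_X {𝔞 : Ideal R} {y : R[X]}
    (hy : y ∈ 𝔞.map (C : R →+* R[X]) ⊔ Ideal.span {(X : R[X])}) : y.coeff 0 ∈ 𝔞 := by
  obtain ⟨u, hu, v, hv, rfl⟩ := Submodule.mem_sup.mp hy
  rw [coeff_add]
  refine Ideal.add_mem _ ((Ideal.mem_map_C_iff.mp hu) 0) ?_
  obtain ⟨w, rfl⟩ := Ideal.mem_span_singleton'.mp hv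
  simp

/-- Powers of `𝔞 R[X] + (X)`, coefficientwise (necessity): `g ∈ (𝔞 R[X] + (X))ⁿ` implies
`coeff_b g ∈ 𝔞ⁿ⁻ᵇ` for every `b`. [folklore] -/
theorem Polynomial.coeff_mem_pow_of_mem_sup_span_X_pow {𝔞 : Ideal R} {n : ℕ} {g : R[X]}
    (hg : g ∈ (𝔞.map (C : R →+* R[X]) ⊔ Ideal.span {(X : R[X])}) ^ n) (b : ℕ) :
    g.coeff b ∈ 𝔞 ^ (n - b) := by
  induction n generalizing g b with
  | zero =>
    rw [Nat.zero_sub, pow_zero, Ideal.one_eq_top]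
    exact Submodule.mem_top
  | succ n ih =>
    rw [pow_succ] at hg
    refine Submodule.mul_induction_on hg (fun a ha y hy => ?_) (fun x y hx hy => ?_)
    · rw [coeff_mul]
      refine Submodule.sum_mem _ fun cd hcd => ?_
      rw [mem_antidiagonal] at hcd
      rcases Nat.eq_zero_or_pos cd.2 with h2 | h2
      · have hc : cd.1 = b := by omega
        rw [h2, hc]
        have hmem : a.coeff b * y.coeff 0 ∈ 𝔞 ^ (n - b + 1) := by
          rw [pow_succ]
          exact Ideal.mul_mem_mul (ih ha b) (Polynomial.coeff_zero_mem_of_mem_sup_span_X hy)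
        exact Ideal.pow_le_pow_right (by omega) hmem
      · exact Ideal.pow_le_pow_right (by omega) (Ideal.mul_mem_right _ _ (ih ha cd.1))
    · rw [coeff_add]
      exact Ideal.add_mem _ hx hy

/-- **Powers of `𝔞 R[X] + (X)`, coefficientwise**: `g ∈ (𝔞 R[X] + (X))ⁿ` iff
`coeff_b g ∈ 𝔞ⁿ⁻ᵇ` for every `b` (truncated subtraction), for any ideal `𝔞` of a commutative
ring `R`. [folklore] -/
theorem Polynomial.mem_sup_span_X_pow_iff {𝔞 : Ideal R} {n : ℕ} {g : R[X]} :
    g ∈ (𝔞.map (C : R →+* R[X]) ⊔ Ideal.span {(X : R[X])}) ^ n ↔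
      ∀ b, g.coeff b ∈ 𝔞 ^ (n - b) := by
  refine ⟨Polynomial.coeff_mem_pow_of_mem_sup_span_X_pow, fun hg => ?_⟩
  rw [g.as_sum_support_C_mul_X_pow]
  refine Submodule.sum_mem _ fun b _ => ?_
  have hle : 𝔞.map (C : R →+* R[X]) ≤ 𝔞.map (C : R →+* R[X]) ⊔ Ideal.span {(X : R[X])} :=
    le_sup_left
  have hC : C (g.coeff b) ∈ (𝔞.map (C : R →+* R[X]) ⊔ Ideal.span {(X : R[X])}) ^ (n - b) := by
    have hCb : C (g.coeff b) ∈ (𝔞 ^ (n - b)).map (C : R →+* R[X]) :=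
      Ideal.mem_map_of_mem _ (hg b)
    rw [Ideal.map_pow] at hCb
    exact Ideal.pow_right_mono hle _ hCb
  have hXmem : (X : R[X]) ∈ 𝔞.map (C : R →+* R[X]) ⊔ Ideal.span {(X : R[X])} :=
    Ideal.mem_sup_right (Ideal.mem_span_singleton_self X)
  have hX : (X : R[X]) ^ b ∈ (𝔞.map (C : R →+* R[X]) ⊔ Ideal.span {(X : R[X])}) ^ b :=
    Ideal.pow_mem_pow hXmem b
  have hmem : C (g.coeff b) * X ^ b ∈
      (𝔞.map (C : R →+* R[X]) ⊔ Ideal.span {(X : R[X])}) ^ (n - b + b) := by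
    rw [pow_add]
    exact Ideal.mul_mem_mul hC hX
  exact Ideal.pow_le_pow_right (by omega) hmem

/-- Transport of membership in powers along a ring hom mapping generators to generators.
[folklore] -/
theorem Ideal.map_mem_pow_of_map_le {A B : Type*} [CommRing A] [CommRing B] (φ : A →+* B)
    {J : Ideal A} {K : Ideal B} (hJK : J.map φ ≤ K) {n : ℕ} {g : A} (hg : g ∈ J ^ n) :
    φ g ∈ K ^ n := by
  have hle : (J ^ n).map φ ≤ K ^ n := by
    rw [Ideal.map_pow]
    exact Ideal.pow_right_mono hJK n
  exact hle (Ideal.mem_map_of_mem φ hg)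

/-- The Taylor shift `g ↦ g(X + c)` maps `𝔞 R[X] + (X - a)` into `𝔞 R[X] + (X - (a - c))`.
[folklore] -/
theorem Polynomial.map_taylor_sup_span_X_sub_C_le (𝔞 : Ideal R) (a c : R) :
    (𝔞.map (C : R →+* R[X]) ⊔ Ideal.span {X - C a}).map (taylorAlgHom c : R[X] →+* R[X]) ≤
      𝔞.map (C : R →+* R[X]) ⊔ Ideal.span {X - C (a - c)} := by
  rw [Ideal.map_le_iff_le_comap, sup_le_iff, Ideal.map_le_iff_le_comap, Ideal.span_le,
    Set.singleton_subset_iff]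
  constructor
  · intro r hr
    rw [Ideal.mem_comap, Ideal.mem_comap]
    have : (taylorAlgHom c : R[X] →+* R[X]) (C r) = C r := by simp [taylor_C]
    rw [this]
    exact Ideal.mem_sup_left (Ideal.mem_map_of_mem _ hr)
  · rw [SetLike.mem_coe, Ideal.mem_comap]
    have : (taylorAlgHom c : R[X] →+* R[X]) (X - C a) = X - C (a - c) := by
      simp [taylor_X, taylor_C, map_sub]
      ring
    rw [this]
    exact Ideal.mem_sup_right (Ideal.mem_span_singleton_self _)

/-- **The order at a rational point is read off the Taylor coefficients**: for an ideal `𝔞` of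
`R`, `a ∈ R` and `g ∈ R[X]`,
`g ∈ (𝔞 R[X] + (X - a))ⁿ ⟺ coeff_b (g(X + a)) ∈ 𝔞ⁿ⁻ᵇ` for every `b`. With `R = S` regular
local and `𝔞 = m_S` this computes Cossart–Piltant's `ord_x` at the closed point
`x = (m_S, X - a)` of `Spec S[X]` from the expansion (2.3) of v1 p. 9 (`f_{i,X'}`, `X' = X - a`,
is `coeff_{m-i}` of `taylor a h`). [cite: CossartPiltant2019, Ch. 2 (arXiv v1 p. 9, (2.3))] -/
theorem Polynomial.mem_sup_span_X_sub_C_pow_iff {𝔞 : Ideal R} {a : R} {n : ℕ} {g : R[X]} :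
    g ∈ (𝔞.map (C : R →+* R[X]) ⊔ Ideal.span {X - C a}) ^ n ↔
      ∀ b, (taylor a g).coeff b ∈ 𝔞 ^ (n - b) := by
  rw [← Polynomial.mem_sup_span_X_pow_iff]
  constructor
  · intro hg
    have key := Ideal.map_mem_pow_of_map_le _ (Polynomial.map_taylor_sup_span_X_sub_C_le 𝔞 a a) hg
    simpa [sub_self] using key
  · intro hg
    have hle := Polynomial.map_taylor_sup_span_X_sub_C_le 𝔞 0 (-a)
    simp only [map_zero, sub_zero, zero_sub, neg_neg] at hle
    have key := Ideal.map_mem_pow_of_map_le _ hle hg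
    have htt : (taylorAlgHom (-a) : R[X] →+* R[X]) (taylor a g) = g := by
      change taylor (-a) (taylor a g) = g
      rw [taylor_taylor, neg_add_cancel, taylor_zero]
    rwa [htt] at key

/-- **`m(x) = m` at a rational point** (Cossart–Piltant 2019, Ch. 2, v1 pp. 9–10): for `h` of
degree `m` and the closed point `x = (𝔞, X - a)` (`𝔞 = m_S`), `h ∈ (𝔞 R[X] + (X - a))ᵐ` —
i.e. `ord_x h ≥ m`, hence `ord_x h = m` when `h` is monic, by
`Polynomial.Monic.not_mul_mem_pow_of_natDegree_lt` — iff `f_{i,X-a} ∈ 𝔞ⁱ` for `1 ≤ i ≤ m`,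
where `f_{i,X-a} = coeff_{m-i} (h(X + a))` are the coefficients of the expansion (2.3).
[cite: CossartPiltant2019, Ch. 2 (arXiv v1 p. 9, (2.3))] -/
theorem Polynomial.mem_sup_span_X_sub_C_pow_natDegree_iff {𝔞 : Ideal R} {a : R} {h : R[X]} :
    h ∈ (𝔞.map (C : R →+* R[X]) ⊔ Ideal.span {X - C a}) ^ h.natDegree ↔
      ∀ i, 1 ≤ i → i ≤ h.natDegree → (taylor a h).coeff (h.natDegree - i) ∈ 𝔞 ^ i := by
  rw [Polynomial.mem_sup_span_X_sub_C_pow_iff]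
  constructor
  · intro H i _ hi
    have := H (h.natDegree - i)
    rwa [Nat.sub_sub_self hi] at this
  · intro H b
    by_cases hb : h.natDegree ≤ b
    · have : h.natDegree - b = 0 := by omega
      rw [this, pow_zero, Ideal.one_eq_top]
      exact Submodule.mem_top
    · have hi1 : 1 ≤ h.natDegree - b := by omega
      have := H (h.natDegree - b) hi1 (Nat.sub_le _ _)
      rwa [Nat.sub_sub_self (by omega : b ≤ h.natDegree)] at this

/-! ## The closed point `x = (𝔞, X - a)` and its local ring: `m(x)` from the expansion (2.3)

For `𝔞` maximal (in the paper `𝔞 = m_S`), `𝔑 = 𝔞 R[X] + (X - a)` is a maximal ideal of `R[X]`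
(the closed point of `Spec S[X]` with residue field `S/m_S` and `X`-coordinate `a`), its
powers are `𝔑`-primary, and so the order in the local ring `R[X]_𝔑` — Cossart–Piltant's
`ord_{m_{S[X]_x}}`, whose value at `h` is `m(x)` — is computed in `R[X]` itself. -/

/-- **Powers of a maximal ideal are primary**, elementwise: if `𝔑` is maximal, `s ∉ 𝔑` and
`s x ∈ 𝔑ⁿ` then `x ∈ 𝔑ⁿ`. (With `y s + i = 1`, `i ∈ 𝔑`:
`x = (s x) · y (1 + i + ⋯ + i^{n-1}) + x iⁿ`.) [folklore] -/
theorem Ideal.IsMaximal.mem_pow_of_mul_mem_pow {A : Type*} [CommRing A] {N : Ideal A}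
    (hN : N.IsMaximal) {n : ℕ} {s x : A} (hs : s ∉ N) (hsx : s * x ∈ N ^ n) : x ∈ N ^ n := by
  obtain ⟨y, i, hi, hyi⟩ := hN.exists_inv hs
  have hgeom : (1 - i) * (∑ k ∈ range n, i ^ k) = 1 - i ^ n := mul_neg_geom_sum i n
  have hx : x = (s * x) * (y * ∑ k ∈ range n, i ^ k) + x * i ^ n := by
    have h1 : x * ((1 - i) * ∑ k ∈ range n, i ^ k) + x * i ^ n = x := by
      rw [hgeom]; ring
    have h2 : (1 - i) = y * s := by linear_combination -hyi
    rw [h2] at h1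
    linear_combination -h1
  rw [hx]
  exact Ideal.add_mem _ (Ideal.mul_mem_right _ _ hsx)
    (Ideal.mul_mem_left _ _ (Ideal.pow_mem_pow hi n))

/-- For a maximal ideal `𝔑` of `A` and the localization `S = A_𝔑`: `x/1 ∈ (𝔑 S)ⁿ ⟺ x ∈ 𝔑ⁿ`
(the order at a closed point is computed before localizing). [folklore] -/
theorem Ideal.IsMaximal.algebraMap_mem_maximalIdeal_pow_iff {A : Type*} [CommRing A]
    (N : Ideal A) [hN : N.IsMaximal] (S : Type*) [CommRing S] [Algebra A S]
    [IsLocalization.AtPrime S N] [IsLocalRing S] {n : ℕ} {x : A} :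
    algebraMap A S x ∈ maximalIdeal S ^ n ↔ x ∈ N ^ n := by
  rw [IsLocalization.AtPrime.algebraMap_mem_maximalIdeal_pow_iff N S]
  constructor
  · rintro ⟨s, hs, hsx⟩
    exact Ideal.IsMaximal.mem_pow_of_mul_mem_pow hN hs hsx
  · intro hx
    exact ⟨1, fun h1 => hN.ne_top ((Ideal.eq_top_iff_one N).mpr h1), by rwa [one_mul]⟩

/-- **The ideal of the point `(𝔞, X - a)`**: `𝔞 R[X] + (X - a)` is the kernel of
`R[X] → R/𝔞`, `g ↦ g(a) mod 𝔞`. [folklore] -/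
theorem Polynomial.sup_span_X_sub_C_eq_ker (𝔞 : Ideal R) (a : R) :
    𝔞.map (C : R →+* R[X]) ⊔ Ideal.span {X - C a} =
      RingHom.ker ((Ideal.Quotient.mk 𝔞).comp (evalRingHom a)) := by
  apply le_antisymm
  · rw [sup_le_iff, Ideal.map_le_iff_le_comap, Ideal.span_le, Set.singleton_subset_iff]
    constructor
    · intro r hr
      rw [Ideal.mem_comap, RingHom.mem_ker, RingHom.comp_apply, coe_evalRingHom, eval_C,
        Ideal.Quotient.eq_zero_iff_mem]
      exact hr
    · rw [SetLike.mem_coe, RingHom.mem_ker, RingHom.comp_apply, coe_evalRingHom]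
      simp
  · intro g hg
    rw [RingHom.mem_ker, RingHom.comp_apply, coe_evalRingHom, Ideal.Quotient.eq_zero_iff_mem] at hg
    have hsplit : g = (g - C (g.eval a)) + C (g.eval a) := by ring
    rw [hsplit]
    refine Ideal.add_mem _ (Ideal.mem_sup_right ?_) (Ideal.mem_sup_left (Ideal.mem_map_of_mem _ hg))
    exact Ideal.mem_span_singleton.mpr (X_sub_C_dvd_sub_C_eval)

/-- **`(𝔞, X - a)` is a closed point** when `𝔞` is maximal: `𝔞 R[X] + (X - a)` is a maximal ideal
of `R[X]` (quotient `R/𝔞`). In the paper: the closed points of `Spec S[X]` over `m_S` with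
residue field `k = S/m_S`. [folklore] -/
theorem Polynomial.isMaximal_sup_span_X_sub_C {𝔞 : Ideal R} (h𝔞 : 𝔞.IsMaximal) (a : R) :
    (𝔞.map (C : R →+* R[X]) ⊔ Ideal.span {X - C a}).IsMaximal := by
  rw [Polynomial.sup_span_X_sub_C_eq_ker]
  haveI : IsField (R ⧸ 𝔞) := (Ideal.Quotient.maximal_ideal_iff_isField_quotient 𝔞).mp h𝔞
  letI : Field (R ⧸ 𝔞) := this.toField
  refine RingHom.ker_isMaximal_of_surjective _ fun q => ?_
  obtain ⟨r, rfl⟩ := Ideal.Quotient.mk_surjective q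
  exact ⟨C r, by simp⟩

/-- **`ord_x` at the closed point `x = (𝔞, X - a)` from the expansion (2.3)** (Cossart–Piltant
2019, Ch. 2, v1 p. 9: `m(y) = ord_{m_{S[X]_y}} h`, expansions `h = X'^m + Σ f_{i,X'} X'^{m-i}`,
`X' = X - a`): for `𝔞` maximal (`𝔞 = m_S`), `S' = R[X]_𝔑` the local ring of the closed point
`𝔑 = (𝔞, X - a)`, and any `g ∈ R[X]`:
`g/1 ∈ (𝔑 S')ⁿ ⟺ coeff_b (g(X + a)) ∈ 𝔞ⁿ⁻ᵇ` for all `b`, i.e.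
`ord_x g = min_b (ord_𝔞 (coeff_b g(X + a)) + b)`.
[cite: CossartPiltant2019, Ch. 2 (arXiv v1 p. 9, (2.3))] -/
theorem Polynomial.algebraMap_mem_maximalIdeal_pow_iff_coeff_taylor {𝔞 : Ideal R} (a : R)
    [hN : (𝔞.map (C : R →+* R[X]) ⊔ Ideal.span {X - C a}).IsMaximal] (S' : Type*) [CommRing S']
    [Algebra R[X] S'] [IsLocalization.AtPrime S' (𝔞.map (C : R →+* R[X]) ⊔ Ideal.span {X - C a})]
    [IsLocalRing S'] {n : ℕ} {g : R[X]} :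
    algebraMap R[X] S' g ∈ maximalIdeal S' ^ n ↔ ∀ b, (taylor a g).coeff b ∈ 𝔞 ^ (n - b) := by
  rw [Ideal.IsMaximal.algebraMap_mem_maximalIdeal_pow_iff
      (𝔞.map (C : R →+* R[X]) ⊔ Ideal.span {X - C a}) S',
    Polynomial.mem_sup_span_X_sub_C_pow_iff]

/-- **`m(x) = m ⟺ ord_{m_S} f_{i,X-a} ≥ i` (`1 ≤ i ≤ m`)** at the closed point `x = (m_S, X - a)`
(Cossart–Piltant 2019, Ch. 2, v1 p. 9): for `h` monic of degree `m`, `𝔞` maximal and `S'` the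
local ring of `R[X]` at `𝔑 = (𝔞, X - a)`, `h/1 ∈ (𝔑 S')ᵐ` (i.e. `m(x) ≥ m`, which is `m(x) = m`
by `Polynomial.Monic.le_natDegree_of_algebraMap_mem_maximalIdeal_pow`) iff the coefficients
`f_{i,X-a} = coeff_{m-i} h(X + a)` of the expansion (2.3) satisfy `f_{i,X-a} ∈ 𝔞ⁱ`.
[cite: CossartPiltant2019, Ch. 2 (arXiv v1 p. 9, (2.3))] -/
theorem Polynomial.algebraMap_mem_maximalIdeal_pow_natDegree_iff {𝔞 : Ideal R} (a : R)
    [hN : (𝔞.map (C : R →+* R[X]) ⊔ Ideal.span {X - C a}).IsMaximal] (S' : Type*) [CommRing S']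
    [Algebra R[X] S'] [IsLocalization.AtPrime S' (𝔞.map (C : R →+* R[X]) ⊔ Ideal.span {X - C a})]
    [IsLocalRing S'] {h : R[X]} :
    algebraMap R[X] S' h ∈ maximalIdeal S' ^ h.natDegree ↔
      ∀ i, 1 ≤ i → i ≤ h.natDegree → (taylor a h).coeff (h.natDegree - i) ∈ 𝔞 ^ i := by
  rw [Ideal.IsMaximal.algebraMap_mem_maximalIdeal_pow_iff
      (𝔞.map (C : R →+* R[X]) ⊔ Ideal.span {X - C a}) S',
    Polynomial.mem_sup_span_X_sub_C_pow_natDegree_iff]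

/-! ## Points of `Sing_m 𝒳` over the closed point are rational, with `h ≡ (X - a)^m`

Cossart–Piltant 2019, proof of Prop. 2.3 (v1 pp. 11–12): "Let `h̄ ∈ S/m_S[Z]` be the reduction
of `h` modulo `m_S`. … `x ∈ Sing_m 𝒳` implies `h̄(Z) = (Z - λ)^m` for some `λ ∈ S/m_S`." We prove
it for a maximal ideal `𝔞` (`= m_S`) of an arbitrary commutative ring `R` and any point `𝔑` of
`Spec R[X]` over `𝔞` at which the monic `h` of degree `m ≥ 1` has order `≥ m`: then `𝔑` is the
rational closed point `(𝔞, X - a)` and `h ≡ (X - a)^m mod 𝔞` — so that, after the translation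
`X' := X - a`, `f_{i,X'} ∈ 𝔞` for all `i` (and `f_{i,X'} ∈ 𝔞ⁱ` by
`Polynomial.mem_sup_span_X_sub_C_pow_natDegree_iff`). -/

/-- Over a field: a prime ideal `N` of `k[X]` at which a monic `g` of degree `m ≥ 1` has order
`≥ m` (`t g ∈ Nᵐ` for some `t ∉ N`) is `(X - λ)` with `g = (X - λ)^m`. (`N = (π)`, `π` prime,
`π ∤ t`, so `πᵐ ∣ g`; degrees force `deg π = 1`.) [folklore] -/
theorem Polynomial.exists_eq_X_sub_C_pow_of_mul_mem_pow {k : Type*} [Field k] {N : Ideal k[X]}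
    [hN : N.IsPrime] {g : k[X]} (hg : g.Monic) (hm : 0 < g.natDegree) {t : k[X]} (ht : t ∉ N)
    (htg : t * g ∈ N ^ g.natDegree) :
    ∃ c : k, g = (X - C c) ^ g.natDegree ∧ N = Ideal.span {X - C c} := by
  obtain ⟨π, hπ⟩ := (IsPrincipalIdealRing.principal N).principal
  rw [Ideal.submodule_span_eq] at hπ
  have hgN : g ∈ N := by
    have htg' : t * g ∈ N := Ideal.pow_le_self (by omega) htg
    rcases hN.mem_or_mem htg' with h1 | h1
    · exact absurd h1 ht
    · exact h1
  have hπ0 : π ≠ 0 := by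
    rintro rfl
    rw [hπ, Ideal.span_singleton_zero, Ideal.mem_bot] at hgN
    exact hg.ne_zero hgN
  have hπprime : Prime π := (Ideal.span_singleton_prime hπ0).mp (hπ ▸ hN)
  -- `πᵐ ∣ g`
  have hdvd : π ^ g.natDegree ∣ g := by
    rw [hπ, Ideal.span_singleton_pow, Ideal.mem_span_singleton] at htg
    refine hπprime.pow_dvd_of_dvd_mul_left _ (fun hπt => ht ?_) htg
    rw [hπ, Ideal.mem_span_singleton]
    exact hπt
  -- degrees: `m · deg π ≤ m`, so `deg π ≤ 1`, and `deg π ≠ 0` as `π` is not a unit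
  have hdeg : (π ^ g.natDegree).natDegree ≤ g.natDegree := natDegree_le_of_dvd hdvd hg.ne_zero
  rw [natDegree_pow] at hdeg
  have hπdeg1 : π.natDegree ≤ 1 := by
    by_contra hlt
    have : 2 * g.natDegree ≤ g.natDegree * π.natDegree := by nlinarith
    omega
  have hπdeg0 : π.natDegree ≠ 0 := by
    intro h0
    apply hπprime.not_unit
    rw [eq_C_of_natDegree_eq_zero h0]
    refine isUnit_C.mpr (Ne.isUnit fun hc => hπ0 ?_)
    rw [eq_C_of_natDegree_eq_zero h0, hc, C_0]
  have hπdeg : π.degree = 1 := by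
    rw [degree_eq_natDegree hπ0]
    exact_mod_cast le_antisymm hπdeg1 (Nat.one_le_iff_ne_zero.mpr hπdeg0)
  obtain ⟨c, hc⟩ := exists_root_of_degree_eq_one hπdeg
  have hXc : X - C c ∣ π := dvd_iff_isRoot.mpr hc
  have hdvd' : (X - C c) ^ g.natDegree ∣ g := (pow_dvd_pow_of_dvd hXc _).trans hdvd
  have hmonic : ((X - C c) ^ g.natDegree).Monic := (monic_X_sub_C c).pow _
  have hgeq : g = (X - C c) ^ g.natDegree :=
    eq_of_monic_of_dvd_of_natDegree_le hmonic hg hdvd' (by simp [natDegree_pow])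
  refine ⟨c, hgeq, ?_⟩
  -- `N ∋ X - C c` and `(X - C c)` is maximal
  have hXcN : X - C c ∈ N := hN.mem_of_pow_mem _ (hgeq ▸ hgN)
  have hmax : (Ideal.span {X - C c} : Ideal k[X]).IsMaximal := by
    have := Polynomial.isMaximal_sup_span_X_sub_C (Ideal.bot_isMaximal (K := k)) c
    rwa [Ideal.map_bot, bot_sup_eq] at this
  exact (hmax.eq_of_le hN.ne_top ((Ideal.span_singleton_le_iff_mem _).mpr hXcN)).symm

/-- **Points of `Sing_m 𝒳` over the closed point are rational and `h ≡ (X - a)^m mod m_S`**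
(Cossart–Piltant 2019, proof of Prop. 2.3, v1 pp. 11–12: "`x ∈ Sing_m 𝒳` implies
`h̄(Z) = (Z - λ)^m` for some `λ ∈ S/m_S`"): for a maximal ideal `𝔞` of `R` (`𝔞 = m_S`), a monic
`h ∈ R[X]` of degree `m ≥ 1`, and a prime `𝔑` of `R[X]` over `𝔞` with `ord_𝔑 h ≥ m`
(`s h ∈ 𝔑ᵐ` for some `s ∉ 𝔑`): there is `a ∈ R` with `𝔑 = 𝔞 R[X] + (X - a)` (the rational closed
point with `X`-coordinate `a mod 𝔞`) and `h ≡ (X - a)^m mod 𝔞 R[X]`.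
[cite: CossartPiltant2019, Prop. 2.3 (proof) (arXiv v1 pp. 11–12)] -/
theorem Polynomial.Monic.exists_eq_sup_span_X_sub_C_of_mul_mem_pow {𝔞 : Ideal R}
    (h𝔞 : 𝔞.IsMaximal) {h : R[X]} (hh : h.Monic) (hm : 0 < h.natDegree) {𝔑 : Ideal R[X]}
    [h𝔑 : 𝔑.IsPrime] (h𝔞𝔑 : 𝔞.map (C : R →+* R[X]) ≤ 𝔑) {s : R[X]} (hs : s ∉ 𝔑)
    (hsh : s * h ∈ 𝔑 ^ h.natDegree) :
    ∃ a : R, 𝔑 = 𝔞.map (C : R →+* R[X]) ⊔ Ideal.span {X - C a} ∧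
      h.map (Ideal.Quotient.mk 𝔞) = (X - C (Ideal.Quotient.mk 𝔞 a)) ^ h.natDegree := by
  letI := Ideal.Quotient.field 𝔞
  set φ : R[X] →+* (R ⧸ 𝔞)[X] := mapRingHom (Ideal.Quotient.mk 𝔞) with hφ
  have hφs : Function.Surjective φ := map_surjective _ Ideal.Quotient.mk_surjective
  have hker : RingHom.ker φ = 𝔞.map (C : R →+* R[X]) := by
    rw [hφ, ker_mapRingHom, Ideal.mk_ker]
  have hker' : RingHom.ker φ ≤ 𝔑 := hker ▸ h𝔞𝔑
  haveI hN : (𝔑.map φ).IsPrime := Ideal.map_isPrime_of_surjective hφs hker'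
  have hcomap : (𝔑.map φ).comap φ = 𝔑 := by
    rw [Ideal.comap_map_of_surjective φ hφs, ← RingHom.ker_eq_comap_bot, sup_eq_left.mpr hker']
  have hg : (φ h).Monic := hh.map _
  have hgdeg : (φ h).natDegree = h.natDegree := hh.natDegree_map _
  have ht : φ s ∉ 𝔑.map φ := by
    intro hmem
    apply hs
    rw [← hcomap, Ideal.mem_comap]
    exact hmem
  have htg : φ s * φ h ∈ (𝔑.map φ) ^ (φ h).natDegree := by
    rw [hgdeg, ← map_mul, ← Ideal.map_pow]
    exact Ideal.mem_map_of_mem φ hsh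
  obtain ⟨c, hgc, hNc⟩ :=
    Polynomial.exists_eq_X_sub_C_pow_of_mul_mem_pow hg (hgdeg ▸ hm) ht htg
  obtain ⟨a, rfl⟩ := Ideal.Quotient.mk_surjective c
  refine ⟨a, ?_, ?_⟩
  · have hspan : Ideal.span {X - C (Ideal.Quotient.mk 𝔞 a)} =
        (Ideal.span {X - C a}).map φ := by
      rw [Ideal.map_span, Set.image_singleton]
      congr 2
      simp [hφ]
    rw [← hcomap, hNc, hspan, Ideal.comap_map_of_surjective φ hφs, ← RingHom.ker_eq_comap_bot,
      hker, sup_comm]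
  · rw [← hgdeg]
    exact hgc

/-- **The fibre over `m_S` is the single point `x`** once `h ≡ (X - a)^m mod m_S`:
every prime `𝔑'` of `R[X]` over the maximal ideal `𝔞` containing `h` is the closed point
`(𝔞, X - a)` (cf. Cossart–Piltant 2019, Prop. 2.3 (i) "`η⁻¹(m_S) = {x}` and `k(x) = S/m_S`",
v1 p. 11, of which this is the elementary half). [cite: CossartPiltant2019, Prop. 2.3 (arXiv v1 p. 11)] -/
theorem Polynomial.eq_sup_span_X_sub_C_of_map_eq_X_sub_C_pow {𝔞 : Ideal R} (h𝔞 : 𝔞.IsMaximal)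
    {h : R[X]} {a : R} {m : ℕ}
    (hha : h.map (Ideal.Quotient.mk 𝔞) = (X - C (Ideal.Quotient.mk 𝔞 a)) ^ m) {𝔑' : Ideal R[X]}
    [h𝔑' : 𝔑'.IsPrime] (h𝔞𝔑' : 𝔞.map (C : R →+* R[X]) ≤ 𝔑') (hh𝔑' : h ∈ 𝔑') :
    𝔑' = 𝔞.map (C : R →+* R[X]) ⊔ Ideal.span {X - C a} := by
  -- `h - (X - a)^m ∈ 𝔞 R[X] ⊆ 𝔑'`, so `(X - a)^m ∈ 𝔑'` and `X - a ∈ 𝔑'`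
  have hdiff : h - (X - C a) ^ m ∈ 𝔞.map (C : R →+* R[X]) := by
    rw [← Ideal.mk_ker (I := 𝔞), ← ker_mapRingHom, RingHom.mem_ker, map_sub, coe_mapRingHom, hha]
    simp
  have hXa : (X - C a) ^ m ∈ 𝔑' := by
    have : (X - C a) ^ m = h - (h - (X - C a) ^ m) := by ring
    rw [this]
    exact Ideal.sub_mem _ hh𝔑' (h𝔞𝔑' hdiff)
  have hXa' : X - C a ∈ 𝔑' := h𝔑'.mem_of_pow_mem _ hXa
  have hle : 𝔞.map (C : R →+* R[X]) ⊔ Ideal.span {X - C a} ≤ 𝔑' :=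
    sup_le h𝔞𝔑' ((Ideal.span_singleton_le_iff_mem _).mpr hXa')
  exact ((Polynomial.isMaximal_sup_span_X_sub_C h𝔞 a).eq_of_le h𝔑'.ne_top hle).symm

/-! ## Multiplicity and the factorisation of `h̄`; the purely inseparable case (G)(c)

The order of `h` at a point `𝔑` of `Spec R[X]` over the maximal ideal `𝔞` is bounded by the
multiplicity in `h̄ = h mod 𝔞 ∈ (R/𝔞)[X]` of the prime factor `π` corresponding to `𝔑`:
`ord_𝔑 h ≥ n ⇒ πⁿ ∣ h̄`. Hence the fibre over `𝔞` misses `Sing 𝒳` when `h̄` is squarefree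
("reduced"), and in case (c) of assumption (G) of Cossart–Piltant (v1 §2.3, p. 15: "`h` is
irreducible, `char S = p`, `f_{i,X} = 0`, `1 ≤ i ≤ p - 1`", so `h̄ = X^p - c̄`) a singular point
over `m_S` forces `h̄ = (X - λ)^p`: the first two claims "`η⁻¹(s) = {x}`, `k(x) = k(s)`" of
Prop. 2.10 (v1 p. 15) for `x ∈ Sing 𝒳`, `s = m_S`, in that case. -/

/-- Over a field: if `N ≠ 0` is a prime ideal of `k[X]`, `t ∉ N` and `t g ∈ Nⁿ`, then `N = (π)` for
a prime `π` with `πⁿ ∣ g`. [folklore] -/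
theorem Polynomial.exists_prime_pow_dvd_of_mul_mem_pow {k : Type*} [Field k] {N : Ideal k[X]}
    [hN : N.IsPrime] (hN0 : N ≠ ⊥) {g t : k[X]} (ht : t ∉ N) {n : ℕ} (htg : t * g ∈ N ^ n) :
    ∃ π : k[X], Prime π ∧ N = Ideal.span {π} ∧ π ^ n ∣ g := by
  obtain ⟨π, hπ⟩ := (IsPrincipalIdealRing.principal N).principal
  rw [Ideal.submodule_span_eq] at hπ
  have hπ0 : π ≠ 0 := by
    rintro rfl
    rw [Ideal.span_singleton_zero] at hπ
    exact hN0 hπ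
  have hπprime : Prime π := (Ideal.span_singleton_prime hπ0).mp (hπ ▸ hN)
  refine ⟨π, hπprime, hπ, ?_⟩
  rw [hπ, Ideal.span_singleton_pow, Ideal.mem_span_singleton] at htg
  refine hπprime.pow_dvd_of_dvd_mul_left _ (fun hπt => ht ?_) htg
  rw [hπ, Ideal.mem_span_singleton]
  exact hπt

/-- **`ord_𝔑 h ≥ n ⇒ πⁿ ∣ h̄`**: for a maximal ideal `𝔞` of `R`, a prime `𝔑` of `R[X]` over `𝔞`
other than the generic point `𝔞 R[X]` of the fibre, and `h ∈ R[X]` with `s h ∈ 𝔑ⁿ` for some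
`s ∉ 𝔑`: the image of `𝔑` in `(R/𝔞)[X]` is `(π)` for a prime `π` with `πⁿ ∣ h̄`, and
`𝔑` is the preimage of `(π)`. [folklore] -/
theorem Polynomial.exists_prime_pow_dvd_map_of_mul_mem_pow {𝔞 : Ideal R} (h𝔞 : 𝔞.IsMaximal)
    {𝔑 : Ideal R[X]} [h𝔑 : 𝔑.IsPrime] (h𝔞𝔑 : 𝔞.map (C : R →+* R[X]) ≤ 𝔑)
    (h𝔑ne : 𝔑 ≠ 𝔞.map (C : R →+* R[X])) {h s : R[X]} (hs : s ∉ 𝔑) {n : ℕ} (hsh : s * h ∈ 𝔑 ^ n) :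
    ∃ π : (R ⧸ 𝔞)[X], Prime π ∧
      𝔑 = (Ideal.span {π}).comap (mapRingHom (Ideal.Quotient.mk 𝔞)) ∧
      π ^ n ∣ h.map (Ideal.Quotient.mk 𝔞) := by
  letI := Ideal.Quotient.field 𝔞
  set φ : R[X] →+* (R ⧸ 𝔞)[X] := mapRingHom (Ideal.Quotient.mk 𝔞) with hφ
  have hφs : Function.Surjective φ := map_surjective _ Ideal.Quotient.mk_surjective
  have hker : RingHom.ker φ = 𝔞.map (C : R →+* R[X]) := by
    rw [hφ, ker_mapRingHom, Ideal.mk_ker]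
  have hker' : RingHom.ker φ ≤ 𝔑 := hker ▸ h𝔞𝔑
  haveI hN : (𝔑.map φ).IsPrime := Ideal.map_isPrime_of_surjective hφs hker'
  have hcomap : (𝔑.map φ).comap φ = 𝔑 := by
    rw [Ideal.comap_map_of_surjective φ hφs, ← RingHom.ker_eq_comap_bot, sup_eq_left.mpr hker']
  have hN0 : 𝔑.map φ ≠ ⊥ := by
    intro h0
    apply h𝔑ne
    rw [← hcomap, h0, ← RingHom.ker_eq_comap_bot, hker]
  have ht : φ s ∉ 𝔑.map φ := by
    intro hmem
    apply hs
    rw [← hcomap, Ideal.mem_comap]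
    exact hmem
  have htg : φ s * φ h ∈ (𝔑.map φ) ^ n := by
    rw [← map_mul, ← Ideal.map_pow]
    exact Ideal.mem_map_of_mem φ hsh
  obtain ⟨π, hπ, hNπ, hdvd⟩ := Polynomial.exists_prime_pow_dvd_of_mul_mem_pow hN0 ht htg
  exact ⟨π, hπ, by rw [← hNπ, hcomap], hdvd⟩

/-- **A reduced fibre misses `Sing 𝒳`**: if `h̄ = h mod 𝔞` is squarefree in `(R/𝔞)[X]` (`𝔞`
maximal), then `h` has order `≤ 1` at every point of `Spec R[X]` over `𝔞` containing `h`: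
`s h ∈ 𝔑² ⇒ s ∈ 𝔑`. (Cossart–Piltant, proof of Prop. 2.10, v1 p. 15: "If `h̄(Z)` satisfies (G)
[is reduced], then … `x` is a regular point of `𝒳`.") [cite: CossartPiltant2019, Prop. 2.10 (proof) (arXiv v1 p. 15)] -/
theorem Polynomial.mem_of_mul_mem_sq_of_squarefree_map {𝔞 : Ideal R} (h𝔞 : 𝔞.IsMaximal)
    {h : R[X]} (hsq : Squarefree (h.map (Ideal.Quotient.mk 𝔞))) {𝔑 : Ideal R[X]}
    [h𝔑 : 𝔑.IsPrime] (h𝔞𝔑 : 𝔞.map (C : R →+* R[X]) ≤ 𝔑) (hh𝔑 : h ∈ 𝔑) {s : R[X]}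
    (hsh : s * h ∈ 𝔑 ^ 2) : s ∈ 𝔑 := by
  letI := Ideal.Quotient.field 𝔞
  by_contra hs
  -- `𝔑` is not the generic point of the fibre, since `h ∈ 𝔑` and `h̄ ≠ 0`
  have h𝔑ne : 𝔑 ≠ 𝔞.map (C : R →+* R[X]) := by
    intro heq
    have : h.map (Ideal.Quotient.mk 𝔞) = 0 := by
      rw [← coe_mapRingHom, ← RingHom.mem_ker, ker_mapRingHom, Ideal.mk_ker, ← heq]
      exact hh𝔑
    exact hsq.ne_zero this
  obtain ⟨π, hπ, -, hdvd⟩ :=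
    Polynomial.exists_prime_pow_dvd_map_of_mul_mem_pow h𝔞 h𝔞𝔑 h𝔑ne hs hsh
  rw [pow_two] at hdvd
  exact hπ.not_unit (hsq π hdvd)

/-- **Case (c) of (G): a singular point over `m_S` forces `h̄ = (X - λ)^p`, the fibre being that
single rational point** (Cossart–Piltant 2019, Prop. 2.10 with v1 §2.3 (G)(c), pp. 15–16): let
`𝔞` be a maximal ideal of `R` with `char R/𝔞 = p` prime, and `h ∈ R[X]` with
`h ≡ X^p - c mod 𝔞` (i.e. `h = X^p + f₁X^{p-1} + ⋯ + f_p` with `f₁, …, f_{p-1} ∈ 𝔞`). If some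
point `𝔑` of `Spec R[X]` over `𝔞` containing `h` has `ord_𝔑 h ≥ 2` (`s h ∈ 𝔑²`, `s ∉ 𝔑`), then
`h ≡ (X - a)^p mod 𝔞` for some `a ∈ R` and `𝔑 = (𝔞, X - a)`; by
`Polynomial.eq_sup_span_X_sub_C_of_map_eq_X_sub_C_pow` it is then the only point over `𝔞`.
(Either `c` is a `p`-th power `λ^p` mod `𝔞` and `X^p - c ≡ (X - λ)^p`, or `X^p - c̄` is
irreducible, hence squarefree, and no point over `𝔞` is singular.)
[cite: CossartPiltant2019, Prop. 2.10 (arXiv v1 pp. 15–16)] -/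
theorem Polynomial.exists_map_eq_X_sub_C_pow_of_purelyInseparable {𝔞 : Ideal R}
    (h𝔞 : 𝔞.IsMaximal) {p : ℕ} (hp : p.Prime) [CharP (R ⧸ 𝔞) p] {h : R[X]} {c : R}
    (hhc : h.map (Ideal.Quotient.mk 𝔞) = X ^ p - C (Ideal.Quotient.mk 𝔞 c)) {𝔑 : Ideal R[X]}
    [h𝔑 : 𝔑.IsPrime] (h𝔞𝔑 : 𝔞.map (C : R →+* R[X]) ≤ 𝔑) (hh𝔑 : h ∈ 𝔑) {s : R[X]} (hs : s ∉ 𝔑)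
    (hsh : s * h ∈ 𝔑 ^ 2) :
    ∃ a : R, h.map (Ideal.Quotient.mk 𝔞) = (X - C (Ideal.Quotient.mk 𝔞 a)) ^ p ∧
      𝔑 = 𝔞.map (C : R →+* R[X]) ⊔ Ideal.span {X - C a} := by
  letI := Ideal.Quotient.field 𝔞
  haveI : Fact p.Prime := ⟨hp⟩
  by_cases hroot : ∃ b : R ⧸ 𝔞, b ^ p = Ideal.Quotient.mk 𝔞 c
  · obtain ⟨b, hb⟩ := hroot
    obtain ⟨a, rfl⟩ := Ideal.Quotient.mk_surjective b
    have hha : h.map (Ideal.Quotient.mk 𝔞) = (X - C (Ideal.Quotient.mk 𝔞 a)) ^ p := by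
      rw [hhc, sub_pow_char, ← C_pow, hb]
    exact ⟨a, hha, Polynomial.eq_sup_span_X_sub_C_of_map_eq_X_sub_C_pow h𝔞 hha h𝔞𝔑 hh𝔑⟩
  · exfalso
    push Not at hroot
    have hirr : Irreducible (h.map (Ideal.Quotient.mk 𝔞)) := by
      rw [hhc]
      exact X_pow_sub_C_irreducible_of_prime hp hroot
    exact hs (Polynomial.mem_of_mul_mem_sq_of_squarefree_map h𝔞 hirr.squarefree h𝔞𝔑 hh𝔑 hsh)

/-! ## The hypersurface of the Lean statement: `S[x] = S[X]/(h)`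

In `CossartPiltant2019Local` the hypersurface `𝒳 = Spec S[X]/(h)` of the paper appears as
`Spec S[x]`, `S[x] = Algebra.adjoin S {x} ⊆ L`, for a root `x ∈ L` of the monic `h` with `h`
irreducible over `K = Frac S`. The two agree: the kernel of `S[X] → L`, `X ↦ x`, is `(h)` —
for ANY `S` with fraction field `K` (divisibility by a monic polynomial descends along `S ↪ K`;
no normality is needed), so that
`𝒪_{𝒳,x₀} = S[x]_{x₀}` as used in the Faithfulness notes of `ArithmeticalThreefoldsLocal.lean`. -/

section Hypersurface

variable {S : Type u} [CommRing S] {K : Type u} [Field K] [Algebra S K] [IsFractionRing S K]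
  {L : Type u} [Field L] [Algebra K L] [Algebra S L] [IsScalarTower S K L]

/-- For `h ∈ S[X]` monic and irreducible over `K = Frac S`, and a root `x ∈ L ⊇ K`:
`aeval x g = 0 ⟺ h ∣ g` (`minpoly_K x = h`, and divisibility by the monic `h` descends from
`K[X]` to `S[X]`). [folklore] -/
theorem Polynomial.Monic.aeval_eq_zero_iff_dvd_of_irreducible_map {h : S[X]} (hh : h.Monic)
    (hirr : Irreducible (h.map (algebraMap S K))) {x : L} (hx : aeval x h = 0) (g : S[X]) :
    aeval x g = 0 ↔ h ∣ g := by
  have hK : h.map (algebraMap S K) = minpoly K x :=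
    minpoly.eq_of_irreducible_of_monic hirr (by rwa [aeval_map_algebraMap]) (hh.map _)
  rw [← map_dvd_map (algebraMap S K) (IsFractionRing.injective S K) hh, hK, minpoly.dvd_iff,
    aeval_map_algebraMap]

/-- **`S[x] = S[X]/(h)`**, kernel form: in the setting of `CossartPiltant2019Local` (`S` a domain
with fraction field `K`, `h ∈ S[X]` monic, irreducible over `K`, `x ∈ L` a root), the kernel of
`S[X] → L`, `X ↦ x`, is the principal ideal `(h)`; its image is `S[x] = Algebra.adjoin S {x}`
(`Algebra.adjoin_singleton_eq_range_aeval`). So the paper's `𝒳 = Spec S[X]/(h)` (v1 p. 9,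
(2.2)) is `Spec S[x]`. [cite: CossartPiltant2019, Ch. 2 (arXiv v1 p. 9, (2.2))] -/
theorem Polynomial.Monic.ker_aeval_eq_span_of_irreducible_map {h : S[X]} (hh : h.Monic)
    (hirr : Irreducible (h.map (algebraMap S K))) {x : L} (hx : aeval x h = 0) :
    RingHom.ker ((aeval x : S[X] →ₐ[S] L) : S[X] →+* L) = Ideal.span {h} := by
  ext g
  rw [RingHom.mem_ker, Ideal.mem_span_singleton]
  exact Polynomial.Monic.aeval_eq_zero_iff_dvd_of_irreducible_map (K := K) hh hirr hx g

/-- **`S[X]/(h) ≅ S[x]`** as `S`-algebras, in the setting of `CossartPiltant2019Local`.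
[cite: CossartPiltant2019, Ch. 2 (arXiv v1 p. 9, (2.2))] -/
theorem Polynomial.Monic.nonempty_quotient_span_algEquiv_adjoin {h : S[X]} (hh : h.Monic)
    (hirr : Irreducible (h.map (algebraMap S K))) {x : L} (hx : aeval x h = 0) :
    Nonempty ((S[X] ⧸ Ideal.span {h}) ≃ₐ[S] Algebra.adjoin S ({x} : Set L)) := by
  let f : S[X] →ₐ[S] (aeval x : S[X] →ₐ[S] L).range := (aeval x).rangeRestrict
  have hf : Function.Surjective f := (aeval x).rangeRestrict_surjective
  have hker : RingHom.ker (f : S[X] →+* (aeval x : S[X] →ₐ[S] L).range) = Ideal.span {h} := by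
    rw [← Polynomial.Monic.ker_aeval_eq_span_of_irreducible_map (K := K) hh hirr hx]
    ext g
    simp only [RingHom.mem_ker]
    constructor
    · intro hg
      have := congrArg Subtype.val hg
      exact this
    · intro hg
      exact Subtype.ext hg
  let e₁ : (S[X] ⧸ RingHom.ker (f : S[X] →+* (aeval x : S[X] →ₐ[S] L).range)) ≃ₐ[S]
      (aeval x : S[X] →ₐ[S] L).range := Ideal.quotientKerAlgEquivOfSurjective hf
  let e₀ : (S[X] ⧸ Ideal.span {h}) ≃ₐ[S]
      (S[X] ⧸ RingHom.ker (f : S[X] →+* (aeval x : S[X] →ₐ[S] L).range)) :=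
    Ideal.quotientEquivAlgOfEq S hker.symm
  let e₂ : (aeval x : S[X] →ₐ[S] L).range ≃ₐ[S] Algebra.adjoin S ({x} : Set L) :=
    Subalgebra.equivOfEq _ _ (Algebra.adjoin_singleton_eq_range_aeval S x).symm
  exact ⟨(e₀.trans e₁).trans e₂⟩

end Hypersurface

end Literature.AlgebraicGeometry.Resolution

end
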